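import Summits.NavierStokesRegularity.NavierStokesRegularity.Theorems.TerminalTraceTypeITraceScarL3OfNoSurvivor
import Summits.NavierStokesRegularity.NavierStokesRegularity.Theorems.TerminalTraceTypeITraceScarL3ParabolicL3Floor
import Summits.NavierStokesRegularity.NavierStokesRegularity.Theorems.TerminalTraceTypeITraceScarL3NoEnergyJump
import Summits.NavierStokesRegularity.NavierStokesRegularity.Theorems.TerminalTraceTypeITraceScarL3LocalEnergyIdentityTop

set_option linter.dupNamespace false

/-!
# Item 18385 BY NAME from the exclusion of ONE loud survivor — portrait v2, with the TOP-TIME clauses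
# (nsreg-C26-p1 g4; line `annulus-dichotomy` after ROUND-27…ROUND-34 and s33-3 / s33-4 / #191 (3)(b))

`typeITraceScarL3_of_noSurvivor` (p617362) reduced the item `TerminalTrace.TypeITraceScarL3`
(stmt-NavierStokesRegularity-18385) to the exclusion of a survivor carrying the portrait (S1)–(S6).  Since
then three further FENCES landed, all unconditional tree theorems about the item's binders at EVERY centre:

* (S7) the Barker–Prange `L³` FLOOR in the similarity parabola (`typeI_singular_L3ParabolicFloor`, p620226):
  a universal `γ > 0`, and for the survivor some `S ∈ (0,1/4]`, `t⋆ < T` with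
  `‖u(t)‖_{L³(B̄(x₀, 2√(ν(T−t)/S)))} > γν` for all `t ∈ (t⋆,T)`;
* (S8) NO LOCAL `L²` CONCENTRATION and NO ENERGY JUMP at `T` (`tendsto_localEnergy_sub_top` p619327,
  `tendsto_localEnergy_top` p620572): `∫_{B(x,R)}|u(t) − u(T)|² → 0` and
  `∫_{B(x,R)}|u(t)|² → ∫_{B(x,R)}|u(T)|²` as `t ↑ T`, every centre `x` and radius `R`;
* (S9) the LOCAL ENERGY IDENTITY through `T` (`localEnergyIdentity_top`, p622554): for every cut-off
  `0 ≤ φ ∈ C_c^∞` and `t₀ ∈ (0,T)` the CKN local energy inequality is an EQUALITY on `[t₀,T]`.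

`typeITraceScarL3_of_noSurvivor_top` is the v2 composition: modulo the two printed criteria carried BY NAME
exactly as before, the item follows from `H` = «for every `γ > 0`, no point carries (S1)–(S9) (floor constant
`γ`) together with the item's binders, a backward-singular vertex and an `L³` ball».  `H` is the open LOUD
core typed at the ITEM level; it is NOT proved here.  Kernel bookkeeping only: no new analysis.

WHAT THIS IS NOT: not a proof of 18385, not a Type-I exclusion, NOT Navier–Stokes regularity.
-/

noncomputable section

open MeasureTheory Set Function Metric Filter Topology Literature.Analysis.FluidPDE
open scoped ENNReal NNReal Laplacian ContDiff

namespace Summit.NavierStokesRegularity.NavierStokesRegularity.Theorems.TypeITraceScarL3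

/-- **Item 18385 BY NAME from the exclusion of one loud survivor, portrait v2** (module docstring):
modulo `seregin2019_localWeakL3_epsRegularity` and `albrittonBarker2020_localWeakL3_regularity` carried by
name, `TerminalTrace.TypeITraceScarL3` follows from `H`: for every `γ > 0`, no classical Leray–Hopf
Type-I blow-up has a backward-singular vertex `(T,x₀)` with an `L³` ball `u(T) ∈ L³(B(x₀,ρ))` carrying
(S1) rate constants `≥ √(2ν)`, (S2) log-mean `≥ ν`, (S3)/(S4) local weak-`L³` unbounded on every backward
cylinder and along every `t_k ↑ T`, (S5) no space–time Type-I envelope, (S6) no terminal-layer decay below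
`√σ`, (S7) the parabolic `L³` floor `γν`, (S8) no local `L²` concentration / no energy jump at `T` at any
centre, (S9) the local energy identity through `T` for every cut-off.  Composition of the landed fences;
`H` is the open core. [folklore; BarkerPrange2020 Thm. 2; LeslieShvydkoy2017 Thm. 1.2; Seregin2019 Prop. 1.4;
AlbrittonBarker2020 Thm. 3.1; CaffarelliKohnNirenberg1982 §2] -/
theorem typeITraceScarL3_of_noSurvivor_top
    (hF1 : Literature.Analysis.FluidPDE.seregin2019_localWeakL3_epsRegularity)
    (hFA : Literature.Analysis.FluidPDE.albrittonBarker2020_localWeakL3_regularity)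
    (H : ∀ γ : ℝ, 0 < γ → ∀ (ν T : ℝ), 0 < ν → 0 < T →
      ∀ (u : ℝ → EuclideanSpace ℝ (Fin 3) → EuclideanSpace ℝ (Fin 3))
        (p : ℝ → EuclideanSpace ℝ (Fin 3) → ℝ),
      IsClassicalNSSolutionOn (Set.Ico 0 T) ν 0 u p → IsLerayHopfOn T ν 0 (u 0) u →
      HasRapidSpatialDecay (u 0) → IsTypeIBlowup u T →
      ∀ x₀ : EuclideanSpace ℝ (Fin 3),
      (∀ r : ℝ, 0 < r →
        eLpNorm (Function.uncurry u) ⊤ (volume.restrict (parabolicCylinder r (T, x₀))) = ⊤) →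
      ∀ ρ : ℝ, 0 < ρ → MemLp (u T) 3 (volume.restrict (ball x₀ ρ)) →
      -- (S1) every eventual Type-I constant is at least `√(2ν)`
      (∀ C : ℝ, (∀ᶠ t in 𝓝[<] T, ∀ x, ‖u t x‖ ≤ C / Real.sqrt (T - t)) → 2 * ν ≤ C ^ 2) →
      -- (S2) log-mean at least `ν`: every admissible log-window exponent is `≥ 1`
      (∀ (b : ℝ → ℝ) (δb ρb q K₀ : ℝ), Measurable b → 0 < δb → 0 < ρb → 0 ≤ K₀ →
        (∀ t ∈ Ioo (T - δb) T, ∀ x ∈ ball x₀ ρb, ‖u t x‖ ≤ b t) →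
        (∀ t' t : ℝ, T - δb < t' → t' ≤ t → t < T →
          ∫⁻ τ in Ioo t' t, ENNReal.ofReal (b τ ^ 2) ≤
            ENNReal.ofReal (2 * q * ν * Real.log ((T - t') / (T - t)) + K₀)) →
        1 ≤ q) →
      -- (S3) local weak-L³ unbounded on every backward cylinder at `x₀`
      (∀ M R : ℝ, 0 < R → R ^ 2 ≤ T →
        ¬ (∀ t ∈ Ioo (T - R ^ 2) T, ∀ h : ℝ, 0 < h →
          ENNReal.ofReal (h ^ 3) *
              volume.restrict (ball x₀ R) {x : EuclideanSpace ℝ (Fin 3) | h < ‖u t x‖} ≤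
            ENNReal.ofReal (M ^ 3))) →
      -- (S4) … and along every sequence of times `t_k ↑ T`
      (∀ (M R : ℝ) (s : ℕ → ℝ), 0 < R → R ^ 2 ≤ T → StrictMono s →
        (∀ k, s k ∈ Ioo (T - R ^ 2) T) → Tendsto s atTop (𝓝 T) →
        ¬ (∀ (k : ℕ) (h : ℝ), 0 < h →
          ENNReal.ofReal (h ^ 3) *
              volume.restrict (ball x₀ R) {x : EuclideanSpace ℝ (Fin 3) | h < ‖u (s k) x‖} ≤
            ENNReal.ofReal (M ^ 3))) →
      -- (S5) no space–time Type-I envelope at `x₀`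
      (∀ C' R : ℝ, 0 < C' → 0 < R → R ^ 2 ≤ T →
        ¬ (∀ t ∈ Ioo (T - R ^ 2) T, ∀ x ∈ ball x₀ R, ‖x - x₀‖ * ‖u t x‖ ≤ C')) →
      -- (S6) no terminal-layer decay below `√σ` under any Lipschitz companion
      (∀ ρ₁ Cg T₀ : ℝ, 0 < ρ₁ → 0 < Cg → T₀ < T →
        (∀ t ∈ Ioo T₀ T, ∀ x ∈ ball x₀ ρ₁, ∀ y ∈ ball x₀ (2 * ρ₁),
          ‖u t x‖ - ‖u t y‖ ≤ Cg / (T - t) * dist y x) →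
        ¬ (∀ ε : ℝ, 0 < ε → ∃ τ : ℝ, 0 < τ ∧ τ ≤ 1 ∧ ∃ l₁ : ℝ, 0 < l₁ ∧
          ∀ l : ℝ, 0 < l → l ≤ l₁ → ∀ x ∈ ball x₀ ρ₁,
            ∫⁻ y in ball x l, ‖u (T - τ ^ 2 * l ^ 2 / ν) y‖ₑ ^ 2 ≤ ENNReal.ofReal (ε * τ * l))) →
      -- (S7) the Barker–Prange parabolic `L³` floor with the universal constant `γ`
      (∃ S tStar : ℝ, 0 < S ∧ S ≤ 1 / 4 ∧ tStar < T ∧ ∀ t ∈ Ioo tStar T,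
        ENNReal.ofReal (γ * ν) <
          eLpNorm (u t) 3 (volume.restrict (closedBall x₀ (2 * Real.sqrt (ν * (T - t) / S))))) →
      -- (S8) no local `L²` concentration and no energy jump at `T`, every centre and radius
      (∀ (x : EuclideanSpace ℝ (Fin 3)) (R : ℝ),
        Tendsto (fun t => ∫⁻ z in ball x R, ‖u t z - u T z‖ₑ ^ 2) (𝓝[<] T) (𝓝 0) ∧
        Tendsto (fun t => ∫⁻ z in ball x R, ‖u t z‖ₑ ^ 2) (𝓝[<] T)
          (𝓝 (∫⁻ z in ball x R, ‖u T z‖ₑ ^ 2))) →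
      -- (S9) the local energy identity through `T` for every cut-off `0 ≤ φ ∈ C_c^∞`
      (∀ (φ : EuclideanSpace ℝ (Fin 3) → ℝ), ContDiff ℝ ∞ φ → HasCompactSupport φ → (∀ x, 0 ≤ φ x) →
        ∀ t₀ ∈ Ioo 0 T,
        IntegrableOn (fun s => ∫ x, frobeniusNormSq (fderiv ℝ (u s) x) * φ x) (Ioo t₀ T) ∧
        IntegrableOn (fun s => ∫ x, (ν * ((Δ φ) x * ‖u s x‖ ^ 2) +
          fderiv ℝ φ x (u s x) * ‖u s x‖ ^ 2 + 2 * (p s x * fderiv ℝ φ x (u s x)))) (Ioo t₀ T) ∧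
        (∫ x, φ x * ‖u T x‖ ^ 2) - (∫ x, φ x * ‖u t₀ x‖ ^ 2) +
            2 * ν * (∫ s in Ioo t₀ T, ∫ x, frobeniusNormSq (fderiv ℝ (u s) x) * φ x) =
          ∫ s in Ioo t₀ T, ∫ x, (ν * ((Δ φ) x * ‖u s x‖ ^ 2) +
            fderiv ℝ φ x (u s x) * ‖u s x‖ ^ 2 + 2 * (p s x * fderiv ℝ φ x (u s x)))) →
      False) :
    Summit.NavierStokesRegularity.NavierStokesRegularity.Theses.TerminalTrace.TypeITraceScarL3 := by
  obtain ⟨γ, hγ, hBP⟩ := typeI_singular_L3ParabolicFloor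
  refine typeITraceScarL3_of_noSurvivor hF1 hFA ?_
  intro ν T hν hT u p hcl hLH hdec hTI x₀ hsing ρ hρ hmem h1 h2 h3 h4 h5 h6
  refine H γ hγ ν T hν hT u p hcl hLH hdec hTI x₀ hsing ρ hρ hmem h1 h2 h3 h4 h5 h6 ?_ ?_ ?_
  · -- (S7) from the Barker–Prange floor
    exact hBP ν T hν hT u p hcl hLH hTI x₀ hsing
  · -- (S8) from the no-concentration / no-energy-jump theorems
    exact fun x R => ⟨tendsto_localEnergy_sub_top hν hT hcl hLH hTI x R,
      tendsto_localEnergy_top hν hT hcl hLH hTI x R⟩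
  · -- (S9) from the local energy identity up to the top
    exact fun φ hφ hφc hφ0 t₀ ht₀ => localEnergyIdentity_top hν hT hcl hLH hTI hφ hφc hφ0 ht₀

end Summit.NavierStokesRegularity.NavierStokesRegularity.Theorems.TypeITraceScarL3

end
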